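import Summits.AtomisticToContinuum.Crystallization.Theses.HcpThetaUniversality
import Summits.AtomisticToContinuum.Crystallization.Theorems.CrystalLocalRigidityAssembly

/-!
# Route `HcpThetaUniversality`, item stmt-AtomisticToContinuum-10949 `Assembly`

The assembly of route `AtomisticToContinuum/Crystallization/HcpThetaUniversality`:

`HcpThetaMaxPackings → ThetaMaxImpliesSutherlandBound → LjGroundStatesNearInvSixMax →
NearMaxGroundStatesCrystallize → CrysPeriodicMinAttained → CrysEnergyLimit → Crystallization`.

Bookkeeping (logic + one division), the body of the route's deciding theorem `closes` (rev 4):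
the Bernstein glue `ThetaMaxImpliesSutherlandBound` applied to `HcpThetaMaxPackings` gives
`SutherlandBound`, i.e. `S₆(y) ≤ M · L₆(hcp)` for every finite unit packing `y` of `M` points, hence
`S₆(y)/M ≤ L₆(hcp)` (`div_le_of_le_mul₀`; the case `M = 0` is covered by `L₆(hcp) ≥ 0`,
`tsum_nonneg`), so the conclusion of `LjGroundStatesNearInvSixMax` (benchmark `L₆(hcp) − 1/20`)
implies the hypothesis of `NearMaxGroundStatesCrystallize` (benchmark `S₆(y)/M − 1/20` for every
finite unit packing `y`), giving `IsCrystallizing lennardJones 3`; together with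
`CrysPeriodicMinAttained` and `CrysEnergyLimit` the conjunct
`Crystallization = HasPeriodicGroundStateEnergy ∧ IsCrystallizing` follows from the in-tree
assembly lemma `Literature.StatMech.crystallization_of_isLeast_tendsto_isCrystallizing`
(a least element of the range is the `⨅`, `IsLeast.csInf_eq`).
-/

namespace Summit.AtomisticToContinuum.Crystallization.Theorems

open Literature.MathematicalPhysics.StatisticalMechanics
open scoped BigOperators

/-- **Item stmt-AtomisticToContinuum-10949** (`Assembly`, route `HcpThetaUniversality`):
`HcpThetaMaxPackings → ThetaMaxImpliesSutherlandBound → LjGroundStatesNearInvSixMax →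
NearMaxGroundStatesCrystallize → CrysPeriodicMinAttained → CrysEnergyLimit → Crystallization`.
The Bernstein glue turns Θ-universality of hcp among packings into the `r⁻⁶` packing bound
`SutherlandBound`, which makes the hcp benchmark of `LjGroundStatesNearInvSixMax` dominate
`S₆(y)/M` for every finite unit packing `y`, so the rigidity endgame
`NearMaxGroundStatesCrystallize` applies and gives positional crystallization; the energetic half
is `Literature.StatMech.crystallization_of_isLeast_tendsto_isCrystallizing` (stmt-0622). -/
theorem hcpThetaUniversality_assembly_proof :
    Summit.AtomisticToContinuum.Crystallization.Theses.HcpThetaUniversality.Assembly := by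
  unfold Summit.AtomisticToContinuum.Crystallization.Theses.HcpThetaUniversality.Assembly
  intro hTheta hBernstein hNear hRigid hMin hLim
  -- (1) Bernstein glue: Θ-universality of hcp among packings ⇒ the r⁻⁶ packing bound
  have hS : Summit.AtomisticToContinuum.Crystallization.Theses.HcpThetaUniversality.SutherlandBound :=
    hBernstein hTheta
  -- the hcp benchmark L₆ = Σ_{y ∈ hcp} ‖y‖⁻⁶ is non-negative (covers the empty competitor M = 0)
  have hL : (0 : ℝ) ≤ ∑' y : ↥(hcpStacking 1 (Real.sqrt (2 / 3))),
      ‖(y : EuclideanSpace ℝ (Fin 3))‖⁻¹ ^ 6 :=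
    tsum_nonneg fun y => by positivity
  -- (2) positional half: the conclusion of crux 4 implies the hypothesis of crux 3
  have hpos : IsCrystallizing lennardJones 3 := by
    apply hRigid
    intro x hx
    filter_upwards [hNear x hx] with N hN
    obtain ⟨S, c, hcard, hc1, hc2, hpack, hsum⟩ := hN
    refine ⟨S, c, hcard, hc1, hc2, hpack, ?_⟩
    intro M y hy
    have hy' := hS M y hy
    have hdiv : (∑ i, ∑ j, (dist (y i) (y j))⁻¹ ^ 6) / (M : ℝ) ≤
        ∑' z : ↥(hcpStacking 1 (Real.sqrt (2 / 3))), ‖(z : EuclideanSpace ℝ (Fin 3))‖⁻¹ ^ 6 :=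
      div_le_of_le_mul₀ (Nat.cast_nonneg M) hL (by rw [mul_comm]; exact hy')
    calc (S.card : ℝ) * ((∑ i, ∑ j, (dist (y i) (y j))⁻¹ ^ 6) / M - 1 / 20)
        ≤ (S.card : ℝ) * ((∑' z : ↥(hcpStacking 1 (Real.sqrt (2 / 3))),
            ‖(z : EuclideanSpace ℝ (Fin 3))‖⁻¹ ^ 6) - 1 / 20) := by
          gcongr
      _ ≤ ∑ i ∈ S, ∑ j ∈ S, (c * dist (x N i) (x N j))⁻¹ ^ 6 := hsum
  -- (3) energetic half + conjunction
  exact Literature.StatMech.crystallization_of_isLeast_tendsto_isCrystallizing ⟨hMin, hLim, hpos⟩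

end Summit.AtomisticToContinuum.Crystallization.Theorems
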